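import Summits.QuantumFields.YangMills.Theorems.BalabanUVNodesN12ForestSlice
import Literature.MathematicalPhysics.QuantumFieldTheory.Balaban1983to89.Node00.WilsonActionSecondVariationNearFlat

/-!
# DAG node N12 [B15] — THE FLAT «LEMMA 2.4»-SHAPED COERCIVITY (P♭Q) ON THE FOREST SLICE OF `𝐁_k(Z)`, PER INSTANCE, FROM dag-n12-w3's QUALITATIVE (β)♭ BY COMPACTNESS:
# `c♭·Σ_b‖X_b‖² ≤ d²∕ds² A(e^{sX})|₀ + ‖DΦ_flat(0)X‖²` for every field `X` of the forest slice, some `c♭ > 0`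

[Balaban1984PropagatorsII] = «[B6]», Lemma 2.4 (2.128) p. 245, (2.153) p. 249; [Balaban1989LargeFieldII] = «[LF-II]», p. 357, (1.7)–(1.9) p. 358; [Balaban1985Variational] = «[15]», (4) p. 278,
(16)–(18) p. 280, (44)–(48) p. 285, (82)–(83) p. 290; [Balaban1988Convergent] = «[III]», (2.2) p. 255, (2.10)–(2.13) pp. 256–257; [Balaban1985BackgroundPropagators] (3.10) p. 392.

Cell `pub-ymgap`, HUMAN RULINGS D-0062 ∕ D-0149, lane owner `pub-ymgap-dag-n12-c` (g25, strategy s1).  Key K1⁹ `stmt-QuantumFields-27364`, `--kind proof --supports … --as helper`; count-neutral.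
NEW leaf; CONSUMED BY NAME, nothing modified: dag-n12-w3's `N12ForestSlice.eq_zero_of_fderiv_msChart_one_eq_zero_of_forest_Bj` ((β)♭ at the flat chart: a forest-slice field killed by the flat
linearised constraint with vanishing flat second variation is `0`), dag-n12-w3's `N12FlatChartHnd.deriv_deriv_wilsonAction4_expChart_one_nonneg`, NODE 00's closed form
`Node00.deriv_deriv_wilsonAction4_expChart_one_eq_norm_sq` (`d²∕ds² A(e^{sX})|₀ = (1∕N)·Σ_p ‖(dX)(p)‖²`).

WHY (lane memo `N12-UNIFORMITY-SPEC.md` §8; `B15Prop1FlatCoerciveSplit`).  The (β)-split of the (J0′) producer's Lagrangian-positivity row displays the flat coercivity letter (P), which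
`B15Prop1FlatCoerciveSplit` splits into (P♭Q) — a FLAT «Lemma 2.4»-shaped coercivity WITH the averaging term on the whole slice, [B6] (2.128)'s shape `c‖B‖² ≤ Σ|∂₁B|² + Σ|Q₁B|²` — and (L)
(the flat averages of a kernel field at the background).  (P♭Q) depends on the determining set and the slice only.  dag-n12-w3 proved its QUALITATIVE form at the record: on the forest slice
of `𝐁_k(Z)` the quadratic form `X ↦ d²∕ds² A(e^{sX})|₀ + ‖DΦ_flat(0)X‖²` vanishes only at `X = 0`.  In finite dimension a positive-definite continuous 2-homogeneous function dominates any
continuous 2-homogeneous function up to a constant (compactness of the unit sphere) — so (P♭Q) HOLDS PER INSTANCE with some `c♭ > 0` (a U4-grade existential constant, like the lane's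
`C ∕ ρ ∕ Kτ ∕ M₂`; the quantitative volume-free constant is [B6] (2.128)'s `(12d²)⁻¹L^{−d−1}` per layer — pv09's `B6Lemma24Torus.lemma24_torus`, not consumed here).

CONTENTS (namespace `Summit.QuantumFields.YangMills.BalabanUVNodes.N12FlatAveragedCoerciveOfForest`; theorems only, no `def`, no `instance`, no `sorry`).
§1 ★ `exists_pos_mul_le_of_twoHomogeneous` (finite dimension: `f, g` continuous and 2-homogeneous, `f > 0` off `0` ⇒ `∃ c > 0, c·g ≤ f`).
§2 ★★★ `exists_flatAveragedCoercive_forest_Bj` — at NODE 00's flat multi-scale chart `Φ_flat = msChart F N K k (Bj M₁ Z k) (M˙(1)) 1`, for a forest with (TREE) on `𝐁_k(Z)` (dag-n12-w3's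
`exists_rootedForest_Bj` supplies it): `∃ c♭ > 0, ∀ X` vanishing on the forest's path bonds, `c♭·Σ_b‖X_b‖² ≤ d²∕ds² A(e^{sX})|₀ + ‖DΦ_flat(0) X‖²`; left displayed: `1 ≤ k ≤ m + K`,
`1 ≤ M₁`, the cover divisibility, (TREE) — w3's binders verbatim.

HONEST FRAMING ∕ LOCATED.  Compactness bookkeeping over a landed qualitative theorem; the constant `c♭` is EXISTENTIAL per instance (per `(K, k, M₁, Z, forest)`), NOT print's `(12d²)⁻¹L^{−d−1}`;
the currencies are NODE 00's (`𝔰𝔲(N)` fields, `expChart` at `1`, `msChart`) — the junction with the (β)-split's `ℝ³` ∕ `su2Chart` ∕ `dIterL` letters (`B15Prop1FlatCoerciveSplit`) is a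
separate dictionary step; nothing of Bałaban's estimates asserted; count-neutral helper; N12 NOT discharged; K1⁹ NOT closed; counts unmoved; one finite 𝕋⁴ programme at fixed ε — R4 closes the
conditional finite-𝕋⁴ rung `BalabanLadder.UV` only; NOT continuum ∕ OS ∕ mass gap ∕ Clay.
-/

noncomputable section

open scoped BigOperators Matrix.Norms.L2Operator Topology

namespace Summit.QuantumFields.YangMills.BalabanUVNodes.N12FlatAveragedCoerciveOfForest

open Set Metric Filter
open Literature.MathematicalPhysics.QuantumFieldTheory.Balaban1983to89
open T4Continuum B15DeterminingSets GaugeField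
open T4AdjointCovarianceUnitary (lieSU)
open Node00
open Literature.MathematicalPhysics.QuantumFieldTheory.Balaban1983to89.B14.Eq213DetSet (Bj)
open Literature.MathematicalPhysics.QuantumFieldTheory.Balaban1983to89.B14.Eq213MaximalDomains (side)
open Summit.QuantumFields.YangMills.BalabanUVNodes.N12ForestSlice (eq_zero_of_fderiv_msChart_one_eq_zero_of_forest_Bj)
open Summit.QuantumFields.YangMills.BalabanUVNodes.N12FlatChartHnd (deriv_deriv_wilsonAction4_expChart_one_nonneg)

/-! ## §1  Finite dimension: a positive-definite continuous 2-homogeneous function dominates every continuous 2-homogeneous function -/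

/-- ★ **COMPACTNESS OF THE UNIT SPHERE**: on a finite-dimensional real normed space, if `f` and `g` are continuous and 2-homogeneous (`h (t • x) = t²·h x`) and `f x > 0` for every `x ≠ 0`, then
`c·g ≤ f` for some `c > 0` (`f` attains a positive minimum `m` and `g` a maximum `M` on the unit sphere; `c := m ∕ max M 1`). [cite: BalabanImbrieJaffe1985, (4.6.1) p.313 («0 < Δ» read as a coercivity constant); Balaban1984PropagatorsII, (2.153) p.249] -/
theorem exists_pos_mul_le_of_twoHomogeneous {E : Type*} [NormedAddCommGroup E] [NormedSpace ℝ E] [FiniteDimensional ℝ E]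
    {f g : E → ℝ} (hf : Continuous f) (hg : Continuous g)
    (hf2 : ∀ (t : ℝ) (x : E), f (t • x) = t ^ 2 * f x) (hg2 : ∀ (t : ℝ) (x : E), g (t • x) = t ^ 2 * g x)
    (hpos : ∀ x : E, x ≠ 0 → 0 < f x) :
    ∃ c : ℝ, 0 < c ∧ ∀ x : E, c * g x ≤ f x := by
  have hf0 : f 0 = 0 := by simpa using hf2 0 0
  have hg0 : g 0 = 0 := by simpa using hg2 0 0
  by_cases hS : (Metric.sphere (0 : E) 1).Nonempty
  · obtain ⟨x₀, hx₀, hmin⟩ := (isCompact_sphere (0 : E) 1).exists_isMinOn hS hf.continuousOn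
    obtain ⟨x₁, hx₁, hmax⟩ := (isCompact_sphere (0 : E) 1).exists_isMaxOn hS hg.continuousOn
    have hx₀0 : x₀ ≠ 0 := by
      intro h
      have h1 : ‖x₀‖ = 1 := mem_sphere_zero_iff_norm.mp hx₀
      rw [h, norm_zero] at h1
      exact zero_ne_one h1
    set m := f x₀ with hm
    set M := max (g x₁) 1 with hM
    have hmpos : 0 < m := hpos x₀ hx₀0
    have hMpos : 0 < M := lt_of_lt_of_le one_pos (le_max_right _ _)
    refine ⟨m / M, div_pos hmpos hMpos, fun x => ?_⟩
    by_cases hx : x = 0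
    · subst hx
      rw [hf0, hg0, mul_zero]
    · have hn : ‖x‖ ≠ 0 := norm_ne_zero_iff.mpr hx
      have hnpos : 0 < ‖x‖ := norm_pos_iff.mpr hx
      have hu : ‖x‖⁻¹ • x ∈ Metric.sphere (0 : E) 1 := by
        rw [mem_sphere_zero_iff_norm, norm_smul, norm_inv, norm_norm, inv_mul_cancel₀ hn]
      have hfx : f x = ‖x‖ ^ 2 * f (‖x‖⁻¹ • x) := by
        have h := hf2 ‖x‖ (‖x‖⁻¹ • x)
        rw [smul_smul, mul_inv_cancel₀ hn, one_smul] at h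
        exact h
      have hgx : g x = ‖x‖ ^ 2 * g (‖x‖⁻¹ • x) := by
        have h := hg2 ‖x‖ (‖x‖⁻¹ • x)
        rw [smul_smul, mul_inv_cancel₀ hn, one_smul] at h
        exact h
      have h1 : m ≤ f (‖x‖⁻¹ • x) := (isMinOn_iff.mp hmin) _ hu
      have h2 : g (‖x‖⁻¹ • x) ≤ M := le_trans ((isMaxOn_iff.mp hmax) _ hu) (le_max_left _ _)
      have hsq : 0 < ‖x‖ ^ 2 := by positivity
      rw [hfx, hgx]
      calc m / M * (‖x‖ ^ 2 * g (‖x‖⁻¹ • x)) ≤ m / M * (‖x‖ ^ 2 * M) := by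
            apply mul_le_mul_of_nonneg_left _ (div_pos hmpos hMpos).le
            exact mul_le_mul_of_nonneg_left h2 hsq.le
        _ = ‖x‖ ^ 2 * m := by field_simp
        _ ≤ ‖x‖ ^ 2 * f (‖x‖⁻¹ • x) := mul_le_mul_of_nonneg_left h1 hsq.le
  · refine ⟨1, one_pos, fun x => ?_⟩
    have hx : x = 0 := by
      by_contra h
      apply hS
      refine ⟨‖x‖⁻¹ • x, ?_⟩
      rw [mem_sphere_zero_iff_norm, norm_smul, norm_inv, norm_norm, inv_mul_cancel₀ (norm_ne_zero_iff.mpr h)]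
    subst hx
    rw [hf0, hg0, mul_zero]

/-! ## §2  (P♭Q) on the forest slice of `𝐁_k(Z)` at NODE 00's flat chart, per instance -/

variable {F : T4Family} {N : ℕ} [NeZero N] {K k : ℕ} {M₁ : ℕ} {Z : Set (Site (F.P K) 0)}

/-- ★★★ **THE FLAT «LEMMA 2.4»-SHAPED COERCIVITY ON THE FOREST SLICE, PER INSTANCE.**  At the flat configuration `U = 1` with its own flat datum `M˙(1)` and the record's determining set
`𝐁_k(Z)` (`1 ≤ k ≤ m + K`, `1 ≤ M₁`, the cover divisibility), for a forest `path` in which every site off the tower sites of `𝐁_k(Z)` hangs (dag-n12-w3's (TREE)): there is `c♭ > 0` with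
`c♭·Σ_b‖X_b‖² ≤ d²∕ds² A(e^{sX})|₀ + ‖DΦ_flat(0) X‖²` for EVERY `𝔰𝔲(N)`-field `X` vanishing on the forest's path bonds — [B6] (2.128)'s shape (flat second variation = `(1∕N)‖dX‖²`, the
`∂₁`-term; the flat linearised multi-scale constraint `DΦ_flat(0)`, the `Q`-term), constant existential.  Proof: §1 with `f X := (1∕N)Σ_p‖(dX)(p)‖² + ‖DΦ_flat(0)X‖²`, `g X := Σ_b‖X_b‖²` on the
slice (a finite-dimensional real subspace); `f X = 0 ⇒ X = 0` is dag-n12-w3's `eq_zero_of_fderiv_msChart_one_eq_zero_of_forest_Bj`.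
[cite: Balaban1984PropagatorsII, Lemma 2.4 (2.128) p.245, (2.153) p.249; Balaban1989LargeFieldII, p.357, (1.9) p.358; Balaban1985Variational, (4) p.278, (44)–(48) p.285, (82)–(83) p.290; Balaban1988Convergent, (2.2) p.255, (2.10)–(2.13) pp.256–257; Balaban1985BackgroundPropagators, (3.10) p.392] -/
theorem exists_flatAveragedCoercive_forest_Bj (hk : k ≤ (F.P K).m + (F.P K).K) (hk1 : 1 ≤ k) (hM : 1 ≤ M₁)
    (hdiv : side (F.P K).L M₁ k ∣ (F.P K).sitesPerDir 0)
    {path : Site (F.P K) 0 → List (LStep (F.P K) 0)}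
    (htree : ∀ x : Site (F.P K) 0, x ∉ {z : Site (F.P K) 0 | ∃ j, j ≤ k ∧ ∃ c ∈ bondsOf ((Bj M₁ Z k : DetSet (F.P K)) j), (z = embIter j c.src ∨ z = embIter j c.tgt)} →
      ∃ (x' : Site (F.P K) 0) (s : LStep (F.P K) 0), path x = path x' ++ [s] ∧
        (s.fwd = true → s.bond.src = x' ∧ s.bond.tgt = x) ∧ (s.fwd = false → s.bond.src = x ∧ s.bond.tgt = x')) :
    ∃ cflat : ℝ, 0 < cflat ∧ ∀ X : PBond (F.P K) 0 → lieSU (Fin N), (∀ x, ∀ s ∈ path x, X s.bond = 0) →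
      cflat * ∑ b : PBond (F.P K) 0, ‖X b‖ ^ 2 ≤
        deriv (deriv fun s : ℝ => wilsonAction4 (expChart (1 : GaugeField (F.P K) 0 (SU N)) (s • X))) 0 +
          ‖fderiv ℝ (msChart F N K k (Bj M₁ Z k) (avgFamily (avOfRecord F N K) (1 : GaugeField (F.P K) 0 (SU N))) (1 : GaugeField (F.P K) 0 (SU N))) 0 X‖ ^ 2 := by
  -- the forest slice as a finite-dimensional real subspace
  let Sl : Submodule ℝ (PBond (F.P K) 0 → lieSU (Fin N)) :=
    { carrier := {X | ∀ x, ∀ s ∈ path x, X s.bond = 0}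
      add_mem' := fun {X Y} hX hY x s hs => by
        show X s.bond + Y s.bond = 0
        rw [hX x s hs, hY x s hs, add_zero]
      zero_mem' := fun _ _ _ => rfl
      smul_mem' := fun t X hX x s hs => by
        show t • X s.bond = 0
        rw [hX x s hs, smul_zero] }
  set L := fderiv ℝ (msChart F N K k (Bj M₁ Z k) (avgFamily (avOfRecord F N K) (1 : GaugeField (F.P K) 0 (SU N))) (1 : GaugeField (F.P K) 0 (SU N))) 0 with hL
  -- the two quadratic forms, read on the ambient space
  let curlSq : (PBond (F.P K) 0 → lieSU (Fin N)) → ℝ := fun X =>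
    ∑ p : Plaq (F.P K) 0, ‖X ⟨p.src, p.μ⟩ + X ⟨p.src.shift p.μ, p.ν⟩ - X ⟨p.src.shift p.ν, p.μ⟩ - X ⟨p.src, p.ν⟩‖ ^ 2
  let fA : (PBond (F.P K) 0 → lieSU (Fin N)) → ℝ := fun X => curlSq X / (Fintype.card (Fin N) : ℝ) + ‖L X‖ ^ 2
  let gA : (PBond (F.P K) 0 → lieSU (Fin N)) → ℝ := fun X => ∑ b : PBond (F.P K) 0, ‖X b‖ ^ 2
  have hev : ∀ b : PBond (F.P K) 0, Continuous fun X : PBond (F.P K) 0 → lieSU (Fin N) => X b := fun b => continuous_apply b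
  have hcurl_cont : Continuous curlSq := by
    refine continuous_finsetSum _ fun p _ => ?_
    exact ((((hev _).add (hev _)).sub (hev _)).sub (hev _)).norm.pow 2
  have hfA_cont : Continuous fA := (hcurl_cont.div_const _).add (L.continuous.norm.pow 2)
  have hgA_cont : Continuous gA := continuous_finsetSum _ fun b _ => (hev b).norm.pow 2
  have hcurl2 : ∀ (t : ℝ) (X : PBond (F.P K) 0 → lieSU (Fin N)), curlSq (t • X) = t ^ 2 * curlSq X := by
    intro t X
    simp only [curlSq, Pi.smul_apply, ← smul_add, ← smul_sub, norm_smul, Real.norm_eq_abs, mul_pow, sq_abs, Finset.mul_sum]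
  have hfA2 : ∀ (t : ℝ) (X : PBond (F.P K) 0 → lieSU (Fin N)), fA (t • X) = t ^ 2 * fA X := by
    intro t X
    simp only [fA]
    rw [hcurl2, map_smul, norm_smul, Real.norm_eq_abs, mul_pow, sq_abs, mul_add, mul_div_assoc]
  have hgA2 : ∀ (t : ℝ) (X : PBond (F.P K) 0 → lieSU (Fin N)), gA (t • X) = t ^ 2 * gA X := by
    intro t X
    simp only [gA, Pi.smul_apply, norm_smul, Real.norm_eq_abs, mul_pow, sq_abs, Finset.mul_sum]
  -- the closed form of the flat second variation
  have hflat : ∀ X : PBond (F.P K) 0 → lieSU (Fin N),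
      deriv (deriv fun s : ℝ => wilsonAction4 (expChart (1 : GaugeField (F.P K) 0 (SU N)) (s • X))) 0 = curlSq X / (Fintype.card (Fin N) : ℝ) :=
    fun X => deriv_deriv_wilsonAction4_expChart_one_eq_norm_sq X
  -- restrict to the slice
  have hf_cont : Continuous fun X : Sl => fA (X : PBond (F.P K) 0 → lieSU (Fin N)) := hfA_cont.comp continuous_subtype_val
  have hg_cont : Continuous fun X : Sl => gA (X : PBond (F.P K) 0 → lieSU (Fin N)) := hgA_cont.comp continuous_subtype_val
  have hf2 : ∀ (t : ℝ) (X : Sl), fA ((t • X : Sl) : PBond (F.P K) 0 → lieSU (Fin N)) = t ^ 2 * fA (X : PBond (F.P K) 0 → lieSU (Fin N)) :=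
    fun t X => by rw [Submodule.coe_smul, hfA2]
  have hg2 : ∀ (t : ℝ) (X : Sl), gA ((t • X : Sl) : PBond (F.P K) 0 → lieSU (Fin N)) = t ^ 2 * gA (X : PBond (F.P K) 0 → lieSU (Fin N)) :=
    fun t X => by rw [Submodule.coe_smul, hgA2]
  -- positivity on the slice: dag-n12-w3's (β)♭
  have hposSl : ∀ X : Sl, X ≠ 0 → 0 < fA (X : PBond (F.P K) 0 → lieSU (Fin N)) := by
    intro X hX
    have hN : (0 : ℝ) < (Fintype.card (Fin N) : ℝ) := by
      have : 0 < Fintype.card (Fin N) := by rw [Fintype.card_fin]; exact Nat.pos_of_ne_zero (NeZero.ne N)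
      exact_mod_cast this
    have hcurl0 : 0 ≤ curlSq (X : PBond (F.P K) 0 → lieSU (Fin N)) := Finset.sum_nonneg fun _ _ => by positivity
    have h1 : 0 ≤ curlSq (X : PBond (F.P K) 0 → lieSU (Fin N)) / (Fintype.card (Fin N) : ℝ) := div_nonneg hcurl0 hN.le
    have h2 : 0 ≤ ‖L (X : PBond (F.P K) 0 → lieSU (Fin N))‖ ^ 2 := by positivity
    by_contra hle
    push Not at hle
    have hsum0 : curlSq (X : PBond (F.P K) 0 → lieSU (Fin N)) / (Fintype.card (Fin N) : ℝ) = 0 ∧ ‖L (X : PBond (F.P K) 0 → lieSU (Fin N))‖ ^ 2 = 0 := by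
      constructor <;> linarith
    have hflat0 : deriv (deriv fun s : ℝ => wilsonAction4 (expChart (1 : GaugeField (F.P K) 0 (SU N)) (s • (X : PBond (F.P K) 0 → lieSU (Fin N))))) 0 = 0 := by
      rw [hflat, hsum0.1]
    have hker : L (X : PBond (F.P K) 0 → lieSU (Fin N)) = 0 := by
      have := hsum0.2
      rwa [sq_eq_zero_iff, norm_eq_zero] at this
    have hX0 : (X : PBond (F.P K) 0 → lieSU (Fin N)) = 0 :=
      eq_zero_of_fderiv_msChart_one_eq_zero_of_forest_Bj hk hk1 hM hdiv htree X.2 hker hflat0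
    exact hX (Subtype.ext hX0)
  -- §1 on the slice
  obtain ⟨c, hc, hcle⟩ := exists_pos_mul_le_of_twoHomogeneous (E := Sl) hf_cont hg_cont hf2 hg2 hposSl
  refine ⟨c, hc, fun X hX => ?_⟩
  have h := hcle ⟨X, hX⟩
  rw [hflat X]
  exact h

end Summit.QuantumFields.YangMills.BalabanUVNodes.N12FlatAveragedCoerciveOfForest

end
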